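import Summits.Ventures.PercRepro.MSTightTighteningSplit
import Summits.Ventures.PercRepro.ExcessOneNonTightening

/-!
# Case (α) of the excess split: the (NT) mechanism off the exception

Dossier proofs/MINE1-theoremS.md, Addendum 44 (supplement 1). In case (α) of the excess split at a
tightening direction `r` — the partner family `K` is tight and `X ∩ Y = K ∖∖ K ∪ {e}` — Theorem S
gives `K ∖∖ K = flip R K` with `R = R*(K) ∈ K`, and the proof of Theorem (NT)
(ExcessOneNonTightening.lean) runs verbatim for every difference that is not the exception `e`:
* `t ∪ R ∈ K` for every `t ∈ F₁` with `t ∖ R ≠ e` (`union_Rstar_mem_partner_of_ne`);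
* `s ∩ R ∈ K` for every `s ∈ F₀` with `R ∖ s ≠ e` (`inter_Rstar_mem_partner_of_ne`);
* `t ∖ s ∈ K ∖∖ K` for every `t ∈ F₁`, `s ∈ F₀` with `t ∖ R ≠ e`, `R ∖ s ≠ e`,
  `t ∖ (s ∩ R) ≠ e` and `(t ∪ R) ∖ s ≠ e` (`sdiff_mem_diffs_partner_of_ne`), by the factorisation
  `t ∖ s = (t ∖ (s ∩ R)) ∩ ((t ∪ R) ∖ s)` of two flip members.
So Conjecture (T) of Addendum 44 (`Y = K ∖∖ K ∪ {e}` in case (α)) is open only at the pairs with a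
factor equal to `e`; on the census the exception is one-sided (`e = R ∖ s` for some `s ∈ P₀` and
no `t` has `t ∖ R = e`, or symmetrically).
-/

namespace PercRepro.MSTight

open Finset
open scoped FinsetFamily symmDiff

variable {α : Type*} [DecidableEq α] [Fintype α] {r : α} {F : Finset (Finset α)}

section Alpha

variable (hT : Tight (partner r F)) (hK : (partner r F).Nonempty) {e : Finset α}
  (hXY : diffsX r F ∩ diffsY r F = insert e (partner r F \\ partner r F))
include hT hK hXY

omit hXY in
/-- `R = R*(K) ∈ K`. -/
theorem Rstar_mem_partner_of_tight : Rstar (partner r F) ∈ partner r F :=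
  Rstar_mem_of_dichotomy (dichotomy_of_tight hT) hK

omit hK in
/-- A member of `X ∩ Y` other than `e` is a flip member. -/
theorem mem_flip_of_mem_inter_of_ne {W : Finset α} (hW : W ∈ diffsX r F ∩ diffsY r F)
    (hne : W ≠ e) : W ∈ flip (Rstar (partner r F)) (partner r F) := by
  rw [hXY, mem_insert] at hW
  rcases hW with h | h
  · exact absurd h hne
  · rw [← diffs_eq_flip_of_tight hT]; exact h

/-- **(2b, off the exception)** `t ∪ R ∈ K` for `t ∈ F₁` with `t ∖ R ≠ e`. -/
theorem union_Rstar_mem_partner_of_ne {t : Finset α} (ht : t ∈ partr r F)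
    (hne : t \ Rstar (partner r F) ≠ e) : t ∪ Rstar (partner r F) ∈ partner r F := by
  set R := Rstar (partner r F) with hR
  have hRK : R ∈ partner r F := Rstar_mem_partner_of_tight hT hK
  have haR : r ∉ R := not_mem_of_mem_partner hRK
  obtain ⟨hat, htF⟩ := mem_partr.1 ht
  have h1 : t \ R ∈ F \\ F := by
    refine mem_diffs.2 ⟨insert r t, htF, insert r R, insert_mem_of_mem_partner hRK, ?_⟩
    rw [insert_sdiff_insert, sdiff_insert_of_notMem hat]
  have h2 : insert r (t \ R) ∈ F \\ F := by
    refine mem_diffs.2 ⟨insert r t, htF, R, mem_of_mem_partner hRK, ?_⟩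
    rw [insert_sdiff_of_notMem _ haR]
  have h3 : t \ R ∈ diffsX r F ∩ diffsY r F := by
    refine mem_inter.2 ⟨mem_diffsX_iff.2 ⟨h1, ?_⟩, mem_diffsY_iff.2 ⟨?_, h2⟩⟩ <;>
      simp [hat]
  obtain ⟨k, hk, hkR⟩ := mem_flip.1 (mem_flip_of_mem_inter_of_ne hT hXY h3 hne)
  have e' : k = t ∪ R := by
    ext x
    have hx := Finset.ext_iff.1 hkR x
    simp only [mem_symmDiff, mem_sdiff, mem_union] at hx ⊢
    tauto
  rwa [e'] at hk

/-- **(2a, off the exception)** `s ∩ R ∈ K` for `s ∈ F₀` with `R ∖ s ≠ e`. -/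
theorem inter_Rstar_mem_partner_of_ne {s : Finset α} (hs : s ∈ part0 r F)
    (hne : Rstar (partner r F) \ s ≠ e) : s ∩ Rstar (partner r F) ∈ partner r F := by
  set R := Rstar (partner r F) with hR
  have hRK : R ∈ partner r F := Rstar_mem_partner_of_tight hT hK
  have haR : r ∉ R := not_mem_of_mem_partner hRK
  obtain ⟨hsF, has⟩ := mem_part0.1 hs
  have h1 : R \ s ∈ F \\ F := mem_diffs.2 ⟨R, mem_of_mem_partner hRK, s, hsF, rfl⟩
  have h2 : insert r (R \ s) ∈ F \\ F := by
    refine mem_diffs.2 ⟨insert r R, insert_mem_of_mem_partner hRK, s, hsF, ?_⟩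
    rw [insert_sdiff_of_notMem _ has]
  have h3 : R \ s ∈ diffsX r F ∩ diffsY r F := by
    refine mem_inter.2 ⟨mem_diffsX_iff.2 ⟨h1, ?_⟩, mem_diffsY_iff.2 ⟨?_, h2⟩⟩ <;>
      simp [haR]
  obtain ⟨k, hk, hkR⟩ := mem_flip.1 (mem_flip_of_mem_inter_of_ne hT hXY h3 hne)
  have e' : k = s ∩ R := by
    ext x
    have hx := Finset.ext_iff.1 hkR x
    simp only [mem_symmDiff, mem_sdiff, mem_inter] at hx ⊢
    tauto
  rwa [e'] at hk

/-- **(3, off the exception)** `t ∖ s ∈ K ∖∖ K` for `t ∈ F₁`, `s ∈ F₀` when none of `t ∖ R`,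
`R ∖ s`, `t ∖ (s ∩ R)`, `(t ∪ R) ∖ s` is the exception `e`. -/
theorem sdiff_mem_diffs_partner_of_ne {t s : Finset α} (ht : t ∈ partr r F) (hs : s ∈ part0 r F)
    (hne_t : t \ Rstar (partner r F) ≠ e) (hne_s : Rstar (partner r F) \ s ≠ e)
    (hne₁ : t \ (s ∩ Rstar (partner r F)) ≠ e) (hne₂ : (t ∪ Rstar (partner r F)) \ s ≠ e) :
    t \ s ∈ partner r F \\ partner r F := by
  set R := Rstar (partner r F) with hR
  have hdich := dichotomy_of_tight hT
  have hRK : R ∈ partner r F := Rstar_mem_partner_of_tight hT hK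
  have haR : r ∉ R := not_mem_of_mem_partner hRK
  obtain ⟨hat, htF⟩ := mem_partr.1 ht
  obtain ⟨hsF, has⟩ := mem_part0.1 hs
  have hsR : s ∩ R ∈ partner r F := inter_Rstar_mem_partner_of_ne hT hK hXY hs hne_s
  have htR : t ∪ R ∈ partner r F := union_Rstar_mem_partner_of_ne hT hK hXY ht hne_t
  -- first factor
  have hW₁ : t \ (s ∩ R) ∈ flip R (partner r F) := by
    have h1 : t \ (s ∩ R) ∈ F \\ F := by
      refine mem_diffs.2 ⟨insert r t, htF, insert r (s ∩ R), insert_mem_of_mem_partner hsR, ?_⟩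
      rw [insert_sdiff_insert, sdiff_insert_of_notMem hat]
    have h2 : insert r (t \ (s ∩ R)) ∈ F \\ F := by
      refine mem_diffs.2 ⟨insert r t, htF, s ∩ R, mem_of_mem_partner hsR, ?_⟩
      rw [insert_sdiff_of_notMem _ (fun h => has (mem_inter.1 h).1)]
    refine mem_flip_of_mem_inter_of_ne hT hXY ?_ hne₁
    refine mem_inter.2 ⟨mem_diffsX_iff.2 ⟨h1, ?_⟩, mem_diffsY_iff.2 ⟨?_, h2⟩⟩ <;> simp [hat]
  -- second factor
  have hW₂ : (t ∪ R) \ s ∈ flip R (partner r F) := by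
    have h1 : (t ∪ R) \ s ∈ F \\ F := mem_diffs.2 ⟨t ∪ R, mem_of_mem_partner htR, s, hsF, rfl⟩
    have h2 : insert r ((t ∪ R) \ s) ∈ F \\ F := by
      refine mem_diffs.2 ⟨insert r (t ∪ R), insert_mem_of_mem_partner htR, s, hsF, ?_⟩
      rw [insert_sdiff_of_notMem _ has]
    refine mem_flip_of_mem_inter_of_ne hT hXY ?_ hne₂
    refine mem_inter.2 ⟨mem_diffsX_iff.2 ⟨h1, ?_⟩, mem_diffsY_iff.2 ⟨?_, h2⟩⟩ <;>
      simp [hat, haR]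
  have e' : t \ s = (t \ (s ∩ R)) ∩ ((t ∪ R) \ s) := by
    ext x
    simp only [mem_sdiff, mem_inter, mem_union]
    tauto
  rw [diffs_eq_flip_of_tight hT, e']
  exact mem_flip_of_subset_of_twinClosed hdich hW₁ inter_subset_left
    ((twinClosed_of_mem_flip hW₁).inter (twinClosed_of_mem_flip hW₂))

end Alpha

end PercRepro.MSTight
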